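import Literature.MathematicalPhysics.KineticTheory.DiPernaLionsCollisionTermsProofs
import Literature.MathematicalPhysics.KineticTheory.DiPernaLionsExtractionProofs
import HarnessLib

/-!
# The entropy inequality of the DiPerna–Lions weak limit: lower semicontinuity of the entropy

Topic: MathematicalPhysics / KineticTheory. First layer of the proof of the named fact (B3)
`Literature.MathematicalPhysics.KineticTheory.diPernaLions_limit_entropyInequality` of
`Literature.MathematicalPhysics.KineticTheory.DiPernaLionsLimit` (DiPerna–Lions, Arch. Rational
Mech. Anal. 114 (1991); Lions, LNM 1551 (1993) Thm III.4 with (E) p. 54; Cercignani–Illner–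
Pulvirenti 1994 §5.3 Step 14, last display p. 160): the weak limit `f` of the approximating
sequence satisfies `H(f(t)) + ∫₀ᵗ ∫ D_B(f) dx ds ≤ H(f(0))`.

The printed proof has three ingredients: (i) the entropy identity (3.7) of each approximate
solution and the convergence `H(fⁿ(0)) → H(f₀)` of the initial entropies (hypotheses of (B3));
(ii) **lower semicontinuity of the entropy** `H(f(t)) ≤ liminfₙ H(fⁿ(t))` along the weakly
convergent slices; (iii) **lower semicontinuity of the entropy dissipation**
`∫₀ᵗ∫ D_B(f) ≤ liminfₙ ∫₀ᵗ∫∫ ẽₙ(fⁿ)` (CIP p. 160: weak convergence of the normalised products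
`fⁿfⁿ_*/(1 + δ∫fⁿ dξ)`, `fⁿ'fⁿ'_*/(1 + δ∫fⁿ dξ)` "from the proof of Lemma 5.3.11" — i.e. from
velocity averaging — and the joint convexity of `(x, y) ↦ (x - y) log (x/y)`).

This file **proves** (ii) and the assembly of (B3) from (iii):

* `integral_mul_log_le_of_tendstoWeaklyL1`: if `fₙ ≥ 0`, `fₙ ⇀ g` weakly in `L¹(μ)`,
  `∫ fₙ w ≤ C` for a weight `w ≥ 0` with `e^{-εw} ∈ L¹(μ)` for all `ε > 0`, and
  `∫ fₙ log fₙ ≤ L` frequently, then `∫ g log g ≤ L` (the classical argument: the tails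
  `∫_{w > R} fₙ log⁻ fₙ ≤ ε ∫ fₙ w + ∫_{w>R} e^{-εw-1}` are uniformly small, and on `{w ≤ R}` the
  tangent lines of `y log y` at the truncated limit `(g ∧ eᴷ) ∨ e⁻ᴷ` are bounded test functions);
* `IsDiPernaLionsWeakLimit.boltzmannEntropy_le_of_frequently_le`: the specialisation to the
  slices of the DiPerna–Lions weak limit, `H(f(t)) ≤ L` whenever `H(f^{φ(k)}(t)) ≤ L` frequently;
* `intervalIntegral_totalEntropyProduction_eq_toReal`: the Bochner-valued dissipation
  `∫₀ᵗ ∫ D_B(f(s, x, ·)) dx ds` of `Literature.Analysis.FluidPDE.HasEntropyInequality` equals the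
  lower Lebesgue integral `∫⁻_{(0,t] × E} e_B(f)` (`eEntropyProduction`) whenever the latter is
  finite, for nonnegative jointly measurable `f` and `B ≥ 0` measurable;
* `IsDiPernaLionsWeakLimit.hasEntropyInequality_of_dissipation_le_liminf`: **(B3) from (iii)**:
  if along the extracted subsequence
  `∫⁻_{(0,t]×E} e_B(f) ≤ liminf_k ∫⁻_{(0,t]×E} ẽ_{φ k}(f^{φ k})` for every `t > 0`, then the weak
  limit satisfies `Literature.Analysis.FluidPDE.HasEntropyInequality B f`.

Ingredient (iii) rests on the velocity-averaging lemma (CIP Lemma 5.3.9, the named fact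
`velocityAverage_relativelyCompact_L1` of `VelocityAveraging`) and is the subject of the sequel.

## References

* R. J. DiPerna, P.-L. Lions, *Global solutions of Boltzmann's equation and the entropy
  inequality*, Arch. Rational Mech. Anal. 114 (1991) 47–55.
* P.-L. Lions, *Global solutions of kinetic models and related problems*, in: Nonequilibrium
  Problems in Many-Particle Systems, LNM 1551 (1993): (E) p. 54, Thm III.4 and Rem. III.8 p. 57.
* C. Cercignani, R. Illner, M. Pulvirenti, *The Mathematical Theory of Dilute Gases*, Springer
  (1994), §5.3: Lemma 5.3.1 (3.7), (3.9), (3.11) (pp. 141–142), Step 10 (3.32) (p. 152), Step 14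
  (p. 160).
-/

open MeasureTheory Metric Real Set Filter Topology
open scoped InnerProductSpace ENNReal

noncomputable section

namespace Literature.MathematicalPhysics.KineticTheory

/-! ## Lower semicontinuity of `∫ f log f` under weak `L¹` convergence -/

section EntropyLsc

variable {α : Type*} [MeasurableSpace α] {μ : Measure α}

/-- The pointwise bound behind the tightness of the negative part of the entropy: for `y ≥ 0`
and `a ≥ 0`, `-(y log y) ≤ a y + e^{-a-1}` (Fenchel–Young for `-y log y`; CIP 1994 (3.11)).
[folklore] -/
theorem neg_mul_log_le {y a : ℝ} (hy : 0 ≤ y) (ha : 0 ≤ a) :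
    -(y * log y) ≤ y * a + exp (-a - 1) := by
  have h1 := mul_negLog_le hy ha
  have h2 : 0 ≤ y * log⁺ y := mul_nonneg hy posLog_nonneg
  have h3 : y * (log⁺ y - log y) = y * log⁺ y - y * log y := by ring
  linarith

/-- **Tail bound for the entropy** (CIP 1994 (3.11): the negative part of `f log f` is
controlled by moments): for `u ≥ 0` with `u log u, u w ∈ L¹`, `w ≥ 0`, `ε ≥ 0` and any
measurable set `s`, `∫_s u log u ≥ -(ε ∫ u w + ∫_s e^{-εw-1})`. [cite: CIPDiluteGases1994, §5.3 Lemma 5.3.1 (3.11) (p. 142)] -/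
theorem neg_le_setIntegral_mul_log {u w : α → ℝ} (hu0 : 0 ≤ᵐ[μ] u)
    (hulog : Integrable (fun x => u x * log (u x)) μ)
    (huw : Integrable (fun x => u x * w x) μ) (hw0 : ∀ x, 0 ≤ w x) {ε : ℝ} (hε : 0 ≤ ε)
    (hexp : Integrable (fun x => exp (-(ε * w x) - 1)) μ) (s : Set α) :
    -(ε * ∫ x, u x * w x ∂μ + ∫ x in s, exp (-(ε * w x) - 1) ∂μ) ≤
      ∫ x in s, u x * log (u x) ∂μ := by
  have hpt : ∀ᵐ x ∂μ.restrict s,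
      -(ε * (u x * w x) + exp (-(ε * w x) - 1)) ≤ u x * log (u x) := by
    filter_upwards [ae_restrict_of_ae hu0] with x hx
    have := neg_mul_log_le hx (mul_nonneg hε (hw0 x))
    have e : u x * (ε * w x) = ε * (u x * w x) := by ring
    linarith
  have hint : Integrable (fun x => -(ε * (u x * w x) + exp (-(ε * w x) - 1))) (μ.restrict s) :=
    ((huw.restrict.const_mul ε).add hexp.restrict).neg
  calc -(ε * ∫ x, u x * w x ∂μ + ∫ x in s, exp (-(ε * w x) - 1) ∂μ)
      ≤ -(ε * ∫ x in s, u x * w x ∂μ + ∫ x in s, exp (-(ε * w x) - 1) ∂μ) := by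
        have : ∫ x in s, u x * w x ∂μ ≤ ∫ x, u x * w x ∂μ :=
          setIntegral_le_integral huw (hu0.mono fun x hx => mul_nonneg hx (hw0 x))
        nlinarith
    _ = ∫ x in s, -(ε * (u x * w x) + exp (-(ε * w x) - 1)) ∂μ := by
        rw [integral_neg, integral_add (huw.restrict.const_mul ε) hexp.restrict, integral_const_mul]
    _ ≤ ∫ x in s, u x * log (u x) ∂μ := integral_mono_ae hint hulog.restrict hpt

/-- `max (min y (exp K)) (exp (-K)) > 0`. [folklore] -/
theorem clamp_exp_pos (K y : ℝ) : 0 < max (min y (exp K)) (exp (-K)) :=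
  lt_of_lt_of_le (exp_pos _) (le_max_right _ _)

/-- `|log (max (min y (exp K)) (exp (-K)))| ≤ K` for `K ≥ 0`. [folklore] -/
theorem abs_log_clamp_exp_le {K : ℝ} (hK : 0 ≤ K) (y : ℝ) :
    |log (max (min y (exp K)) (exp (-K)))| ≤ K := by
  have h1 : exp (-K) ≤ max (min y (exp K)) (exp (-K)) := le_max_right _ _
  have h2 : max (min y (exp K)) (exp (-K)) ≤ exp K :=
    max_le (min_le_right _ _) (exp_le_exp.2 (by linarith))
  rw [abs_le]
  constructor
  · have := log_le_log (exp_pos _) h1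
    rwa [log_exp] at this
  · have := log_le_log (clamp_exp_pos K y) h2
    rwa [log_exp] at this

/-- For `y > 0`, clamping towards `[e⁻ᴷ, eᴷ]` does not increase `|log|`:
`|log (max (min y (exp K)) (exp (-K)))| ≤ |log y|`. [folklore] -/
theorem abs_log_clamp_exp_le_abs_log {K y : ℝ} (hK : 0 ≤ K) (hy : 0 < y) :
    |log (max (min y (exp K)) (exp (-K)))| ≤ |log y| := by
  rcases le_total y (exp K) with h1 | h1
  · rw [min_eq_left h1]
    rcases le_total (exp (-K)) y with h2 | h2
    · rw [max_eq_left h2]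
    · rw [max_eq_right h2, log_exp, abs_neg, abs_of_nonneg hK]
      have := log_le_log hy h2
      rw [log_exp] at this
      have hlogy : log y ≤ 0 := by linarith
      rw [abs_of_nonpos hlogy]
      linarith
  · rw [min_eq_right h1, max_eq_left (exp_le_exp.2 (by linarith)), log_exp, abs_of_nonneg hK]
    have := log_le_log (exp_pos K) h1
    rw [log_exp] at this
    exact le_trans this (le_abs_self _)

/-- `max (min y (exp K)) (exp (-K)) ≤ y + 1` for `y ≥ 0`, `K ≥ 0`. [folklore] -/
theorem clamp_exp_le_add_one {K y : ℝ} (hK : 0 ≤ K) (hy : 0 ≤ y) :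
    max (min y (exp K)) (exp (-K)) ≤ y + 1 := by
  refine max_le ((min_le_left _ _).trans (by linarith)) ?_
  have : exp (-K) ≤ 1 := exp_le_one_iff.2 (by linarith)
  linarith

/-- For `y > 0`, `max (min y (exp K)) (exp (-K)) = y` for all large natural `K`. [folklore] -/
theorem eventually_clamp_exp_eq {y : ℝ} (hy : 0 < y) :
    ∀ᶠ K : ℕ in atTop, max (min y (exp K)) (exp (-K)) = y := by
  have h1 : ∀ᶠ K : ℕ in atTop, |log y| ≤ (K : ℝ) :=
    tendsto_natCast_atTop_atTop.eventually_ge_atTop _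
  filter_upwards [h1] with K hK
  rw [abs_le] at hK
  have hyK : y ≤ exp K := by
    rw [← log_le_iff_le_exp hy]; exact hK.2
  have hKy : exp (-(K : ℝ)) ≤ y := by
    rw [← exp_log hy]; exact exp_le_exp.2 hK.1
  rw [min_eq_left hyK, max_eq_left hKy]

/-- Measurability of the clamped function `(G ∧ eᴷ) ∨ e⁻ᴷ`. [folklore] -/
theorem measurable_clamp_exp {G : α → ℝ} (hG : Measurable G) (K : ℝ) :
    Measurable fun x => max (min (G x) (exp K)) (exp (-K)) :=
  (hG.min measurable_const).max measurable_const

/-- Level sets `{w ≤ R}` of a weight with `e^{-w} ∈ L¹` have finite measure. [folklore] -/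
theorem measure_setOf_le_lt_top {w : α → ℝ} (hw : Measurable w)
    (hexp : Integrable (fun x => exp (-w x)) μ) (R : ℝ) : μ {x | w x ≤ R} < ∞ := by
  set s := {x | w x ≤ R} with hs
  have hsm : MeasurableSet s := measurableSet_le hw measurable_const
  have h1 : ENNReal.ofReal (exp (-R)) * μ s ≤ ∫⁻ x in s, ENNReal.ofReal (exp (-w x)) ∂μ := by
    rw [← setLIntegral_const]
    refine setLIntegral_mono (hw.neg.exp.ennreal_ofReal) fun x hx => ?_
    exact ENNReal.ofReal_le_ofReal (exp_le_exp.2 (by simpa [hs] using hx))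
  have h2 : ∫⁻ x in s, ENNReal.ofReal (exp (-w x)) ∂μ < ∞ :=
    lt_of_le_of_lt (setLIntegral_le_lintegral _ _)
      (hexp.hasFiniteIntegral.lt_top.trans_le' (lintegral_mono fun x =>
        (Real.enorm_eq_ofReal (exp_pos _).le).ge))
  have h3 : ENNReal.ofReal (exp (-R)) * μ s < ∞ := h1.trans_lt h2
  have hpos : ENNReal.ofReal (exp (-R)) ≠ 0 := (ENNReal.ofReal_pos.2 (exp_pos _)).ne'
  exact (ENNReal.mul_lt_top_iff.1 h3).elim (fun h => h.2) fun h =>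
    h.elim (fun h => absurd h hpos) fun h => by rw [h]; exact ENNReal.zero_lt_top

/-- **Lower semicontinuity of the entropy under weak `L¹` convergence with uniformly bounded
moments** (DiPerna–Lions 1991; the entropy half of Lions 1993 Thm III.4 (E); CIP 1994 (3.32) and
(3.11)). Let `fₙ ≥ 0` be integrable with `fₙ log fₙ ∈ L¹`, `fₙ ⇀ g` weakly in `L¹(μ)` with
`g, g log g ∈ L¹`, let `w ≥ 0` be a measurable weight with `e^{-εw} ∈ L¹(μ)` for every `ε > 0` and
`∫ fₙ w ≤ C` for all `n`. If `∫ fₙ log fₙ ≤ L` for infinitely many `n`, then `∫ g log g ≤ L`; that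
is, `∫ g log g ≤ liminfₙ ∫ fₙ log fₙ`. [cite: Lions1993Kinetic, Thm III.4 (p. 57) and (E) (p. 54)] -/
theorem integral_mul_log_le_of_tendstoWeaklyL1 {f : ℕ → α → ℝ} {g : α → ℝ}
    (h : Literature.Analysis.FunctionSpaces.TendstoWeaklyL1 f g μ)
    (hf : ∀ n, 0 ≤ᵐ[μ] f n) (hfi : ∀ n, Integrable (f n) μ)
    (hflog : ∀ n, Integrable (fun x => f n x * log (f n x)) μ)
    (hg : Integrable g μ) (hglog : Integrable (fun x => g x * log (g x)) μ)
    {w : α → ℝ} (hw : Measurable w) (hw0 : ∀ x, 0 ≤ w x)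
    (hexp : ∀ ε > 0, Integrable (fun x => exp (-(ε * w x))) μ)
    (hfw : ∀ n, Integrable (fun x => f n x * w x) μ) {C : ℝ} (hC : ∀ n, ∫ x, f n x * w x ∂μ ≤ C)
    {L : ℝ} (hL : ∃ᶠ n in atTop, ∫ x, f n x * log (f n x) ∂μ ≤ L) :
    ∫ x, g x * log (g x) ∂μ ≤ L := by
  -- Step 0: a nonnegative Borel version `G` of the limit
  have hg0 : 0 ≤ᵐ[μ] g := h.ae_nonneg hf hg
  set G : α → ℝ := fun x => max (hg.1.mk g x) 0 with hG_def
  have hGm : Measurable G := hg.1.stronglyMeasurable_mk.measurable.max measurable_const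
  have hG0 : ∀ x, 0 ≤ G x := fun x => le_max_right _ _
  have hgG : g =ᵐ[μ] G := by
    filter_upwards [hg.1.ae_eq_mk, hg0] with x hx hx0
    have hx0' : 0 ≤ g x := hx0
    simp only [hG_def]
    rw [← hx, max_eq_left hx0']
  have hGi : Integrable G μ := hg.congr hgG
  have hGlog : Integrable (fun x => G x * log (G x)) μ :=
    hglog.congr (hgG.mono fun x hx => by simp only [hx])
  have hGw : Literature.Analysis.FunctionSpaces.TendstoWeaklyL1 f G μ := h.congr_limit hgG
  rw [integral_congr_ae (hgG.mono fun x hx => show g x * log (g x) = G x * log (G x) by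
    simp only [hx])]
  -- it suffices to prove `∫ G log G ≤ L + ε` for every `ε > 0`
  refine _root_.le_of_forall_pos_le_add fun ε hε => ?_
  -- constants
  set C' : ℝ := max C 0 with hC'
  have hC'0 : 0 ≤ C' := le_max_right _ _
  have hCn : ∀ n, ∫ x, f n x * w x ∂μ ≤ C' := fun n => (hC n).trans (le_max_left _ _)
  set ε₁ : ℝ := ε / (4 * (C' + 1)) with hε₁
  have hε₁0 : 0 < ε₁ := by positivity
  have hε₁C : ε₁ * C' ≤ ε / 4 := by
    rw [hε₁, div_mul_eq_mul_div, div_le_div_iff₀ (by positivity) (by positivity)]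
    nlinarith
  -- the tail weight `e₁ = e^{-ε₁ w - 1}`
  set e₁ : α → ℝ := fun x => exp (-(ε₁ * w x) - 1) with he₁
  have he₁i : Integrable e₁ μ := by
    refine ((hexp ε₁ hε₁0).mul_const (exp (-1))).congr (ae_of_all _ fun x => ?_)
    simp only [he₁]
    rw [← Real.exp_add]
    ring_nf
  -- Step 1: choice of `R`: the level sets `S_R = {w ≤ R}`
  set S : ℕ → Set α := fun R => {x | w x ≤ R} with hS_def
  have hSm : ∀ R, MeasurableSet (S R) := fun R => measurableSet_le hw measurable_const
  have hSmono : Monotone S := fun R R' hRR' x (hx : w x ≤ R) =>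
    show w x ≤ R' from hx.trans (Nat.cast_le.2 hRR')
  have hSuniv : (⋃ R, S R) = univ := by
    refine eq_univ_of_forall fun x => mem_iUnion.2 ⟨⌈w x⌉₊, ?_⟩
    exact Nat.le_ceil (w x)
  have hT1 : Tendsto (fun R => ∫ x in S R, G x * log (G x) ∂μ) atTop
      (𝓝 (∫ x, G x * log (G x) ∂μ)) := by
    have := tendsto_setIntegral_of_monotone hSm hSmono (hGlog.integrableOn (s := ⋃ R, S R))
    rwa [hSuniv, Measure.restrict_univ] at this
  have hT2 : Tendsto (fun R => ∫ x in (S R)ᶜ, e₁ x ∂μ) atTop (𝓝 0) := by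
    have hanti : Antitone fun R => (S R)ᶜ := fun R R' hRR' => compl_subset_compl.2 (hSmono hRR')
    have := tendsto_setIntegral_of_antitone (fun R => (hSm R).compl) hanti
      ⟨0, he₁i.integrableOn⟩
    have hempty : (⋂ R, (S R)ᶜ) = ∅ := by
      rw [← compl_iUnion, hSuniv, compl_univ]
    rwa [hempty, Measure.restrict_empty, integral_zero_measure] at this
  obtain ⟨R, hR1, hR2⟩ : ∃ R : ℕ, dist (∫ x in S R, G x * log (G x) ∂μ) (∫ x, G x * log (G x) ∂μ)
      < ε / 4 ∧ dist (∫ x in (S R)ᶜ, e₁ x ∂μ) 0 < ε / 4 := by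
    have h1 := (Metric.tendsto_nhds.1 hT1) (ε / 4) (by positivity)
    have h2 := (Metric.tendsto_nhds.1 hT2) (ε / 4) (by positivity)
    exact (h1.and h2).exists
  set s := S R with hs_def
  have hsm : MeasurableSet s := hSm R
  have hμs : μ s < ∞ := by
    have := hexp 1 one_pos
    simp only [one_mul] at this
    exact measure_setOf_le_lt_top hw this R
  haveI : IsFiniteMeasure (μ.restrict s) := ⟨by rwa [Measure.restrict_apply_univ]⟩
  set tail : ℝ := ∫ x in sᶜ, e₁ x ∂μ with htail
  have htail0 : 0 ≤ tail := setIntegral_nonneg hsm.compl fun x _ => (exp_pos _).le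
  have htailε : tail ≤ ε / 4 := by
    have := hR2
    rw [Real.dist_eq, sub_zero, abs_of_nonneg htail0] at this
    exact this.le
  have hR1' : ∫ x, G x * log (G x) ∂μ ≤ ∫ x in s, G x * log (G x) ∂μ + ε / 4 := by
    have := hR1
    rw [Real.dist_eq] at this
    linarith [(abs_lt.1 this).1]
  -- Step 2: the tangent-line bound on `s`, for every `K`
  have hstep : ∀ K : ℕ,
      ∫ x in s, (G x * (1 + log (max (min (G x) (exp K)) (exp (-K)))) -
        max (min (G x) (exp K)) (exp (-K))) ∂μ ≤ L + ε₁ * C' + tail := by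
    intro K
    have hK0 : (0 : ℝ) ≤ K := Nat.cast_nonneg K
    set c : α → ℝ := fun x => max (min (G x) (exp K)) (exp (-K)) with hc_def
    have hcm : Measurable c := measurable_clamp_exp hGm K
    have hcpos : ∀ x, 0 < c x := fun x => clamp_exp_pos K (G x)
    set τ : α → ℝ := fun x => 1 + log (c x) with hτ_def
    have hτm : Measurable τ := measurable_const.add hcm.log
    have hτbd : ∀ x, |τ x| ≤ 1 + K := fun x => by
      simp only [hτ_def]
      calc |1 + log (c x)| ≤ |(1 : ℝ)| + |log (c x)| := abs_add_le _ _
        _ ≤ 1 + K := by rw [abs_one]; exact add_le_add le_rfl (abs_log_clamp_exp_le hK0 _)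
    have hτbd' : ∀ᵐ x ∂μ.restrict s, ‖τ x‖ ≤ 1 + K :=
      ae_of_all _ fun x => (Real.norm_eq_abs _).le.trans (hτbd x)
    -- `c` is integrable on `s`
    have hci : Integrable c (μ.restrict s) := by
      refine (hGi.restrict.add (integrable_const (1 : ℝ))).mono' hcm.aestronglyMeasurable
        (ae_of_all _ fun x => ?_)
      rw [Real.norm_eq_abs, abs_of_pos (hcpos x)]
      exact clamp_exp_le_add_one hK0 (hG0 x)
    -- (a) the bound along the sequence
    have hseq : ∀ n, ∫ x in s, f n x * τ x ∂μ ≤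
        ∫ x, f n x * log (f n x) ∂μ + ∫ x in s, c x ∂μ + ε₁ * C' + tail := by
      intro n
      -- tangent inequality on `s`
      have h1 : ∫ x in s, (f n x * τ x - c x) ∂μ ≤ ∫ x in s, f n x * log (f n x) ∂μ := by
        refine integral_mono_ae (((hfi n).restrict.mul_bdd hτm.aestronglyMeasurable hτbd').sub hci)
          (hflog n).restrict ?_
        filter_upwards [ae_restrict_of_ae (hf n)] with x hx
        have := tangent_le_mul_log hx (hcpos x)
        simp only [hτ_def]
        linarith
      rw [integral_sub ((hfi n).restrict.mul_bdd hτm.aestronglyMeasurable hτbd') hci] at h1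
      -- tail bound on `sᶜ`
      have h2 := neg_le_setIntegral_mul_log (hf n) (hflog n) (hfw n) hw0 hε₁0.le he₁i sᶜ
      -- splitting `∫ = ∫_s + ∫_sᶜ`
      have h3 := integral_add_compl hsm (hflog n)
      have h4 : ε₁ * ∫ x, f n x * w x ∂μ ≤ ε₁ * C' := mul_le_mul_of_nonneg_left (hCn n) hε₁0.le
      linarith
    -- (b) frequently, and passage to the weak limit
    have hfreq : ∃ᶠ n in atTop, ∫ x in s, f n x * τ x ∂μ ≤
        L + ∫ x in s, c x ∂μ + ε₁ * C' + tail :=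
      hL.mono fun n hn => (hseq n).trans (by linarith)
    have hconv : Tendsto (fun n => ∫ x in s, f n x * τ x ∂μ) atTop
        (𝓝 (∫ x in s, G x * τ x ∂μ)) :=
      (hGw.restrict hsm) τ (1 + K) hτm.aestronglyMeasurable (ae_of_all _ hτbd)
    have hlim : ∫ x in s, G x * τ x ∂μ ≤ L + ∫ x in s, c x ∂μ + ε₁ * C' + tail :=
      le_of_tendsto_of_frequently hconv hfreq
    rw [integral_sub (hGi.restrict.mul_bdd hτm.aestronglyMeasurable hτbd') hci]
    linarith
  -- Step 3: `K → ∞` by dominated convergence on `s`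
  have hDCT : Tendsto (fun K : ℕ =>
      ∫ x in s, (G x * (1 + log (max (min (G x) (exp K)) (exp (-K)))) -
        max (min (G x) (exp K)) (exp (-K))) ∂μ) atTop (𝓝 (∫ x in s, G x * log (G x) ∂μ)) := by
    set bound : α → ℝ := fun x => 2 * G x + |G x * log (G x)| + 1 with hbound
    refine tendsto_integral_of_dominated_convergence bound (fun K => ?_) ?_ (fun K => ?_) ?_
    · exact ((hGm.mul (measurable_const.add (measurable_clamp_exp hGm K).log)).sub
        (measurable_clamp_exp hGm K)).aestronglyMeasurable
    · exact ((hGi.restrict.const_mul 2).add hGlog.restrict.abs).add (integrable_const _)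
    · refine ae_of_all _ fun x => ?_
      have hK0 : (0 : ℝ) ≤ K := Nat.cast_nonneg K
      have hGx := hG0 x
      set c : ℝ := max (min (G x) (exp K)) (exp (-K)) with hc_def
      have hc0 : 0 ≤ c := (clamp_exp_pos K (G x)).le
      have hc1 : c ≤ G x + 1 := clamp_exp_le_add_one hK0 hGx
      have hlog : |G x * log c| ≤ |G x * log (G x)| := by
        rcases eq_or_lt_of_le hGx with h0 | hpos
        · rw [← h0]; simp
        · rw [abs_mul, abs_mul, abs_of_pos hpos]
          exact mul_le_mul_of_nonneg_left (abs_log_clamp_exp_le_abs_log hK0 hpos) hpos.le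
      rw [Real.norm_eq_abs, hbound]
      calc |G x * (1 + log c) - c|
          ≤ |G x * (1 + log c)| + |c| := abs_sub _ _
        _ = |G x + G x * log c| + c := by rw [mul_add, mul_one, abs_of_nonneg hc0]
        _ ≤ (|G x| + |G x * log c|) + c := add_le_add (abs_add_le _ _) le_rfl
        _ ≤ (G x + |G x * log (G x)|) + (G x + 1) := by
            rw [abs_of_nonneg hGx]; exact add_le_add (add_le_add le_rfl hlog) hc1
        _ = 2 * G x + |G x * log (G x)| + 1 := by ring
    · refine ae_of_all _ fun x => ?_
      rcases eq_or_lt_of_le (hG0 x) with h0 | hpos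
      · -- `G x = 0`: the integrand is `-e^{-K} → 0`
        rw [← h0]
        simp only [zero_mul, zero_sub, log_zero, mul_zero]
        have h1 : Tendsto (fun K : ℕ => max (min (0 : ℝ) (exp (K : ℝ))) (exp (-(K : ℝ)))) atTop
            (𝓝 0) := by
          have : (fun K : ℕ => max (min (0 : ℝ) (exp (K : ℝ))) (exp (-(K : ℝ)))) =
              fun K : ℕ => exp (-(K : ℝ)) := by
            funext K
            rw [min_eq_left (exp_pos _).le, max_eq_right (exp_pos _).le]
          rw [this]
          exact Real.tendsto_exp_neg_atTop_nhds_zero.comp tendsto_natCast_atTop_atTop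
        simpa using h1.neg
      · -- `G x > 0`: the integrand is eventually constant `= G log G`
        refine tendsto_const_nhds.congr' ?_
        filter_upwards [eventually_clamp_exp_eq hpos] with K hK
        rw [hK]
        ring
  have hsle : ∫ x in s, G x * log (G x) ∂μ ≤ L + ε₁ * C' + tail := le_of_tendsto' hDCT hstep
  -- Step 4: assemble
  linarith

end EntropyLsc

/-! ## The entropy of the slices of the DiPerna–Lions weak limit -/

section Slices

variable {E : Type*} [NormedAddCommGroup E] [InnerProductSpace ℝ E] [FiniteDimensional ℝ E]
  [MeasurableSpace E] [BorelSpace E]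

/-- A density `g ≥ 0` on `E × E` with `∫∫ g (1 + |x|² + |v|² + |log g|) ≤ C` times a multiplier
dominated by `1 + |x|² + |v|² + |log g|` is integrable, with `∫∫ |g ψ| ≤ C ∨ 0`. [folklore] -/
theorem integrable_mul_of_massEntropy_le {g : E × E → ℝ}
    (hgm : AEStronglyMeasurable g ((volume : Measure E).prod volume)) (hg0 : ∀ z, 0 ≤ g z) {C : ℝ}
    (hC : ∫⁻ z, ENNReal.ofReal (g z * (1 + ‖z.1‖ ^ 2 + ‖z.2‖ ^ 2 + |log (g z)|))
      ∂((volume : Measure E).prod volume) ≤ ENNReal.ofReal C)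
    {ψ : E × E → ℝ} (hψm : AEStronglyMeasurable ψ ((volume : Measure E).prod volume))
    (hψ : ∀ z, |ψ z| ≤ 1 + ‖z.1‖ ^ 2 + ‖z.2‖ ^ 2 + |log (g z)|) :
    Integrable (fun z => g z * ψ z) ((volume : Measure E).prod volume) ∧
      ∫ z, |g z * ψ z| ∂((volume : Measure E).prod volume) ≤ max C 0 := by
  have hle : ∀ z, ‖g z * ψ z‖ₑ ≤
      ENNReal.ofReal (g z * (1 + ‖z.1‖ ^ 2 + ‖z.2‖ ^ 2 + |log (g z)|)) := fun z => by
    rw [Real.enorm_eq_ofReal_abs, abs_mul, abs_of_nonneg (hg0 z)]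
    exact ENNReal.ofReal_le_ofReal (mul_le_mul_of_nonneg_left (hψ z) (hg0 z))
  have hfin : ∫⁻ z, ‖g z * ψ z‖ₑ ∂((volume : Measure E).prod volume) ≤ ENNReal.ofReal C :=
    (lintegral_mono hle).trans hC
  have hint : Integrable (fun z => g z * ψ z) ((volume : Measure E).prod volume) :=
    ⟨hgm.mul hψm, hfin.trans_lt ENNReal.ofReal_lt_top⟩
  refine ⟨hint, ?_⟩
  have h1 : ∫ z, |g z * ψ z| ∂((volume : Measure E).prod volume) =
      (∫⁻ z, ‖g z * ψ z‖ₑ ∂((volume : Measure E).prod volume)).toReal := by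
    rw [← integral_norm_eq_lintegral_enorm hint.1]
    rfl
  rw [h1, ← ENNReal.toReal_ofReal']
  exact ENNReal.toReal_mono ENNReal.ofReal_ne_top hfin

/-- The Boltzmann entropy of a density with `g log g ∈ L¹(E × E)` is the product integral
`∫∫ g log g` (Fubini). [folklore] -/
theorem boltzmannEntropy_eq_integral_prod {g : E → E → ℝ}
    (hg : Integrable (fun z : E × E => g z.1 z.2 * log (g z.1 z.2))
      ((volume : Measure E).prod volume)) :
    Literature.Analysis.FluidPDE.boltzmannEntropy g =
      ∫ z : E × E, g z.1 z.2 * log (g z.1 z.2) ∂((volume : Measure E).prod volume) := by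
  rw [Literature.Analysis.FluidPDE.boltzmannEntropy, integral_prod _ hg]

/-- The Gaussian weights `e^{-ε(|x|² + |v|²)}`, `ε > 0`, are integrable on `E × E`. [folklore] -/
theorem integrable_exp_neg_mul_weight {ε : ℝ} (hε : 0 < ε) :
    Integrable (fun z : E × E => exp (-(ε * (‖z.1‖ ^ 2 + ‖z.2‖ ^ 2))))
      ((volume : Measure E).prod volume) := by
  have h1 : Integrable (fun v : E => exp (-ε * ‖v‖ ^ 2)) :=
    Literature.Analysis.FluidPDE.integrable_exp_neg_mul_sq_norm hε
  refine (h1.mul_prod h1).congr (ae_of_all _ fun z => ?_)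
  simp only
  rw [← Real.exp_add]
  congr 1
  ring

namespace IsDiPernaLionsWeakLimit

variable {f₀ : E → E → ℝ} {fseq : ℕ → ℝ → E → E → ℝ} {φ : ℕ → ℕ} {f : ℝ → E → E → ℝ}

/-- The slices `f(t)`, `t ≥ 0`, of the weak limit times any multiplier dominated by
`1 + |x|² + |v|² + |log f(t)|` are integrable on `E × E` ((3.32)). [folklore] -/
theorem integrable_slice_mul (hW : IsDiPernaLionsWeakLimit f₀ fseq φ f) {t : ℝ} (ht : 0 ≤ t)
    {ψ : E × E → ℝ} (hψm : AEStronglyMeasurable ψ ((volume : Measure E).prod volume))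
    (hψ : ∀ z, |ψ z| ≤ 1 + ‖z.1‖ ^ 2 + ‖z.2‖ ^ 2 + |log (f t z.1 z.2)|) :
    Integrable (fun z : E × E => f t z.1 z.2 * ψ z) ((volume : Measure E).prod volume) := by
  obtain ⟨C, hC⟩ := hW.massEntropy_le t ht
  exact (integrable_mul_of_massEntropy_le (hW.measurable_slice t).aestronglyMeasurable
    (fun z => hW.nonneg t ht z.1 z.2) (hC t ⟨ht, le_rfl⟩) hψm hψ).1

/-- The slices `f(t)`, `t ≥ 0`, of the weak limit are integrable on `E × E`. [folklore] -/
theorem integrable_slice (hW : IsDiPernaLionsWeakLimit f₀ fseq φ f) {t : ℝ} (ht : 0 ≤ t) :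
    Integrable (fun z : E × E => f t z.1 z.2) ((volume : Measure E).prod volume) := by
  have := hW.integrable_slice_mul ht (ψ := fun _ => (1 : ℝ)) aestronglyMeasurable_const
    (fun z => by
      rw [abs_one]
      nlinarith [sq_nonneg ‖z.1‖, sq_nonneg ‖z.2‖, abs_nonneg (log (f t z.1 z.2))])
  simpa using this

/-- `f(t) log f(t) ∈ L¹(E × E)` for the slices `t ≥ 0` of the weak limit ((3.32)). [folklore] -/
theorem integrable_slice_mul_log (hW : IsDiPernaLionsWeakLimit f₀ fseq φ f) {t : ℝ} (ht : 0 ≤ t) :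
    Integrable (fun z : E × E => f t z.1 z.2 * log (f t z.1 z.2))
      ((volume : Measure E).prod volume) :=
  hW.integrable_slice_mul ht (hW.measurable_slice t).log.aestronglyMeasurable fun z => by
    nlinarith [sq_nonneg ‖z.1‖, sq_nonneg ‖z.2‖, abs_nonneg (log (f t z.1 z.2))]

/-- **Lower semicontinuity of the entropy along the slices of the DiPerna–Lions weak limit**
(DiPerna–Lions 1991; Lions 1993 Thm III.4 (E); CIP 1994 Step 14 with (3.32)): for `t ≥ 0`, if
`H(f^{φ(k)}(t)) ≤ L` for infinitely many `k`, then `H(f(t)) ≤ L`; i.e.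
`H(f(t)) ≤ liminf_k H(f^{φ(k)}(t))`. The slices converge weakly in `L¹(E × E)` and obey the
uniform bound (3.21)–(3.22), so `integral_mul_log_le_of_tendstoWeaklyL1` applies with the weight
`|x|² + |v|²`. [cite: Lions1993Kinetic, Thm III.4 (p. 57) and (E) (p. 54)] -/
theorem boltzmannEntropy_le_of_frequently_le (hW : IsDiPernaLionsWeakLimit f₀ fseq φ f)
    {δ : ℕ → ℝ} {Bseq : ℕ → E × E → sphere (0 : E) 1 → ℝ}
    (hsol : ∀ n, IsDiPernaLionsApproximateSolution (δ n) (Bseq n) (fseq n))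
    (hbd : UniformDiPernaLionsBounds δ Bseq fseq) {t : ℝ} (ht : 0 ≤ t) {L : ℝ}
    (hL : ∃ᶠ k in atTop, Literature.Analysis.FluidPDE.boltzmannEntropy (fseq (φ k) t) ≤ L) :
    Literature.Analysis.FluidPDE.boltzmannEntropy (f t) ≤ L := by
  set μ : Measure (E × E) := (volume : Measure E).prod volume with hμ
  set w : E × E → ℝ := fun z => ‖z.1‖ ^ 2 + ‖z.2‖ ^ 2 with hw_def
  have hwm : Measurable w := (measurable_fst.norm.pow_const 2).add (measurable_snd.norm.pow_const 2)
  have hw0 : ∀ z, 0 ≤ w z := fun z => by positivity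
  -- the sequence of slices and its limit
  set fs : ℕ → E × E → ℝ := fun k z => fseq (φ k) t z.1 z.2 with hfs
  set g : E × E → ℝ := fun z => f t z.1 z.2 with hg_def
  have hconv : Literature.Analysis.FunctionSpaces.TendstoWeaklyL1 fs g μ :=
    hW.tendstoWeaklyL1_slice t ht
  have hfs0 : ∀ k z, 0 ≤ fs k z := fun k z => (hsol (φ k)).nonneg t ht z.1 z.2
  have hfsi : ∀ k, Integrable (fs k) μ := fun k => (hsol (φ k)).integrable_slice t ht
  -- the uniform bound (3.21)–(3.22) along the subsequence
  obtain ⟨C, hC⟩ := hbd.massEntropy_le t ht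
  have hCk : ∀ k, ∫⁻ z, ENNReal.ofReal (fs k z * (1 + ‖z.1‖ ^ 2 + ‖z.2‖ ^ 2 + |log (fs k z)|)) ∂μ ≤
      ENNReal.ofReal C := fun k => hC (φ k) t ⟨ht, le_rfl⟩
  have hlogk : ∀ k, Integrable (fun z => fs k z * log (fs k z)) μ := fun k =>
    (integrable_mul_of_massEntropy_le (hfsi k).1 (hfs0 k) (hCk k)
      (hfsi k).1.aemeasurable.log.aestronglyMeasurable
      fun z => by nlinarith [sq_nonneg ‖z.1‖, sq_nonneg ‖z.2‖, abs_nonneg (log (fs k z))]).1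
  have hwk : ∀ k, Integrable (fun z => fs k z * w z) μ ∧ ∫ z, |fs k z * w z| ∂μ ≤ max C 0 :=
      fun k =>
    integrable_mul_of_massEntropy_le (hfsi k).1 (hfs0 k) (hCk k) hwm.aestronglyMeasurable
      fun z => by
        rw [hw_def, abs_of_nonneg (hw0 z)]
        nlinarith [abs_nonneg (log (fs k z))]
  have hwle : ∀ k, ∫ z, fs k z * w z ∂μ ≤ max C 0 := fun k =>
    le_trans (integral_mono (hwk k).1 (hwk k).1.abs fun z => le_abs_self _) (hwk k).2
  -- the limit slice
  have hgi : Integrable g μ := hW.integrable_slice ht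
  have hglog : Integrable (fun z => g z * log (g z)) μ := hW.integrable_slice_mul_log ht
  -- Gaussian weights
  have hexp : ∀ ε > 0, Integrable (fun z => exp (-(ε * w z))) μ := fun ε hε =>
    integrable_exp_neg_mul_weight hε
  -- entropies as product integrals
  have hHk : ∀ k, Literature.Analysis.FluidPDE.boltzmannEntropy (fseq (φ k) t) =
      ∫ z, fs k z * log (fs k z) ∂μ := fun k => boltzmannEntropy_eq_integral_prod (hlogk k)
  have hH : Literature.Analysis.FluidPDE.boltzmannEntropy (f t) = ∫ z, g z * log (g z) ∂μ :=
    boltzmannEntropy_eq_integral_prod hglog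
  rw [hH]
  refine integral_mul_log_le_of_tendstoWeaklyL1 hconv (fun k => ae_of_all _ (hfs0 k)) hfsi hlogk
    hgi hglog hwm hw0 hexp (fun k => (hwk k).1) hwle ?_
  exact hL.mono fun k hk => by rwa [hHk k] at hk

end IsDiPernaLionsWeakLimit

end Slices

/-! ## The Bochner-valued dissipation of `HasEntropyInequality` versus `eEntropyProduction` -/

section Dissipation

variable {E : Type*} [NormedAddCommGroup E] [InnerProductSpace ℝ E] [FiniteDimensional ℝ E]
  [MeasurableSpace E] [BorelSpace E]

omit [FiniteDimensional ℝ E] [MeasurableSpace E] [BorelSpace E] in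
/-- The integrand of the entropy production is pointwise nonnegative for `B ≥ 0` and `h ≥ 0`,
with Mathlib's conventions `x / 0 = 0`, `log 0 = 0` at the vanishing points of `h` (where the
true integrand may be `+∞`). [folklore] -/
theorem entropyProductionIntegrand_nonneg_of_nonneg {B : E × E → sphere (0 : E) 1 → ℝ}
    (hB : ∀ p ω, 0 ≤ B p ω) {h : E → ℝ} (h0 : ∀ v, 0 ≤ h v)
    (q : (E × E) × sphere (0 : E) 1) : 0 ≤ entropyProductionIntegrand B h q := by
  unfold entropyProductionIntegrand
  refine mul_nonneg (hB _ _) ?_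
  set a := h (KineticTheory.collide q.2 q.1).1 * h (KineticTheory.collide q.2 q.1).2 with ha_def
  set b := h q.1.1 * h q.1.2 with hb_def
  have ha : 0 ≤ a := mul_nonneg (h0 _) (h0 _)
  have hb : 0 ≤ b := mul_nonneg (h0 _) (h0 _)
  rcases eq_or_lt_of_le hb with hb0 | hb0
  · rw [← hb0, div_zero, log_zero, mul_zero]
  rcases eq_or_lt_of_le ha with ha0 | ha0
  · rw [← ha0, zero_div, log_zero, mul_zero]
  rcases le_total b a with hab | hab
  · exact mul_nonneg (sub_nonneg.2 hab) (log_nonneg ((one_le_div hb0).2 hab))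
  · exact mul_nonneg_of_nonpos_of_nonpos (sub_nonpos.2 hab)
      (log_nonpos (div_pos ha0 hb0).le ((div_le_one hb0).2 hab))

omit [NormedAddCommGroup E] [InnerProductSpace ℝ E] [FiniteDimensional ℝ E] [BorelSpace E] in
/-- A jointly measurable density on `ℝ × E × E`, read as a measurable family of velocity
densities indexed by `(t, x)`. [folklore] -/
theorem measurable_uncurry_slice {f : ℝ → E → E → ℝ}
    (hfm : Measurable fun z : ℝ × E × E => f z.1 z.2.1 z.2.2) :
    Measurable (Function.uncurry fun (p : ℝ × E) (v : E) => f p.1 p.2 v) :=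
  hfm.comp (measurable_fst.fst.prodMk (measurable_fst.snd.prodMk measurable_snd))

/-- Measurability of `(t, x) ↦ e_B(f(t, x, ·))` for a jointly measurable density. [folklore] -/
theorem measurable_eEntropyProduction_param {B : E × E → sphere (0 : E) 1 → ℝ}
    (hBm : Measurable (Function.uncurry B)) {f : ℝ → E → E → ℝ}
    (hfm : Measurable fun z : ℝ × E × E => f z.1 z.2.1 z.2.2) :
    Measurable fun p : ℝ × E => eEntropyProduction B (f p.1 p.2) := by
  haveI := Literature.Analysis.FluidPDE.isFiniteMeasure_sphereMeasure (E := E)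
  unfold eEntropyProduction
  exact (measurable_const.mul (measurable_entropyProductionIntegrand_param hBm
    (measurable_uncurry_slice hfm))).ennreal_ofReal.lintegral_prod_right'

/-- For `B ≥ 0` and `h ≥ 0` with a measurable entropy-production integrand, the Bochner-valued
entropy production is the real part of the `ℝ≥0∞`-valued one (both vanish when the latter is
infinite). [folklore] -/
theorem entropyProduction_eq_toReal_eEntropyProduction {B : E × E → sphere (0 : E) 1 → ℝ}
    (hB : ∀ p ω, 0 ≤ B p ω) {h : E → ℝ} (h0 : ∀ v, 0 ≤ h v)
    (hm : AEStronglyMeasurable (entropyProductionIntegrand B h)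
      (((volume : Measure E).prod volume).prod KineticTheory.sphereMeasure)) :
    Literature.Analysis.FluidPDE.entropyProduction B h = (eEntropyProduction B h).toReal := by
  rw [entropyProduction_eq_integral, ← integral_const_mul, eEntropyProduction,
    integral_eq_lintegral_of_nonneg_ae (ae_of_all _ fun q => mul_nonneg (by norm_num)
      (entropyProductionIntegrand_nonneg_of_nonneg hB h0 q)) (hm.const_mul _)]

/-- **The Bochner-valued dissipation is the lower Lebesgue one when finite.** For a measurable
kernel `B ≥ 0` and a jointly measurable density `f` with `f(t) ≥ 0` for `t > 0`, if
`∫⁻_{(0,t] × E} e_B(f(s, x, ·)) < ∞` then the dissipation term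
`∫₀ᵗ ∫ D_B(f(s, x, ·)) dx ds` of `Literature.Analysis.FluidPDE.HasEntropyInequality` (iterated
Bochner integrals) equals its real part (Tonelli, and `integral_toReal` twice). [folklore] -/
theorem intervalIntegral_totalEntropyProduction_eq_toReal {B : E × E → sphere (0 : E) 1 → ℝ}
    (hBm : Measurable (Function.uncurry B)) (hB : ∀ p ω, 0 ≤ B p ω) {f : ℝ → E → E → ℝ}
    (hfm : Measurable fun z : ℝ × E × E => f z.1 z.2.1 z.2.2)
    (hf0 : ∀ t, 0 < t → ∀ x v, 0 ≤ f t x v) {t : ℝ} (ht : 0 ≤ t)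
    (hfin : ∫⁻ p in Ioc 0 t ×ˢ univ, eEntropyProduction B (f p.1 p.2)
      ∂((volume : Measure ℝ).prod (volume : Measure E)) ≠ ∞) :
    ∫ s in (0 : ℝ)..t, Literature.Analysis.FluidPDE.totalEntropyProduction B (f s) =
      (∫⁻ p in Ioc 0 t ×ˢ univ, eEntropyProduction B (f p.1 p.2)
        ∂((volume : Measure ℝ).prod (volume : Measure E))).toReal := by
  haveI := Literature.Analysis.FluidPDE.isFiniteMeasure_sphereMeasure (E := E)
  set eEP : ℝ × E → ℝ≥0∞ := fun p => eEntropyProduction B (f p.1 p.2) with heEP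
  have heEPm : Measurable eEP := measurable_eEntropyProduction_param hBm hfm
  -- the restricted product measure is a product
  have hrestr : ((volume : Measure ℝ).prod (volume : Measure E)).restrict (Ioc 0 t ×ˢ univ) =
      ((volume : Measure ℝ).restrict (Ioc 0 t)).prod (volume : Measure E) := by
    rw [← Measure.restrict_univ (μ := (volume : Measure E)), Measure.prod_restrict,
      Measure.restrict_univ]
  set J : ℝ → ℝ≥0∞ := fun s => ∫⁻ x, eEP (s, x) with hJ
  have hJm : Measurable J := heEPm.lintegral_prod_right'
  have hD : ∫⁻ p in Ioc 0 t ×ˢ univ, eEP p ∂((volume : Measure ℝ).prod (volume : Measure E)) =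
      ∫⁻ s in Ioc 0 t, J s := by
    rw [hrestr, lintegral_prod _ heEPm.aemeasurable]
  have hJfin : ∀ᵐ s ∂(volume : Measure ℝ).restrict (Ioc 0 t), J s < ∞ := by
    refine ae_lt_top hJm ?_
    rwa [← hD]
  -- the inner identification, for a.e. `s ∈ (0, t]`
  have hinner : ∀ᵐ s ∂(volume : Measure ℝ).restrict (Ioc 0 t),
      Literature.Analysis.FluidPDE.totalEntropyProduction B (f s) = (J s).toReal := by
    filter_upwards [hJfin, ae_restrict_mem measurableSet_Ioc] with s hs hsI
    have hs0 : ∀ x v, 0 ≤ f s x v := hf0 s hsI.1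
    have hmx : Measurable fun x : E => eEP (s, x) :=
      heEPm.comp (measurable_const.prodMk measurable_id)
    have hptw : ∀ x,
        Literature.Analysis.FluidPDE.entropyProduction B (f s x) = (eEP (s, x)).toReal := by
      intro x
      refine entropyProduction_eq_toReal_eEntropyProduction hB (hs0 x) ?_
      have hq : Measurable fun q : (E × E) × sphere (0 : E) 1 => (((s, x) : ℝ × E), q) :=
        measurable_const.prodMk measurable_id
      exact ((measurable_entropyProductionIntegrand_param hBm (measurable_uncurry_slice hfm)).comp
        hq).aestronglyMeasurable
    have hfinx : ∀ᵐ x ∂(volume : Measure E), eEP (s, x) < ∞ := ae_lt_top hmx hs.ne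
    unfold Literature.Analysis.FluidPDE.totalEntropyProduction
    simp_rw [hptw]
    exact integral_toReal hmx.aemeasurable hfinx
  rw [intervalIntegral.integral_of_le ht, integral_congr_ae hinner,
    integral_toReal hJm.aemeasurable hJfin, hD]

end Dissipation

/-! ## (B3) from the lower semicontinuity of the dissipation -/

section Assembly

variable {E : Type*} [NormedAddCommGroup E] [InnerProductSpace ℝ E] [FiniteDimensional ℝ E]
  [MeasurableSpace E] [BorelSpace E]

/-- **The entropy inequality of the weak limit, given the lower semicontinuity of the
dissipation** (DiPerna–Lions 1991; Lions 1993 Thm III.4 with (E); CIP 1994 §5.3 Step 14, p. 160).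
Let `f` be the DiPerna–Lions weak limit along `φ` of approximate solutions `fⁿ` obeying the
entropy inequality (3.7) and the uniform bounds (3.21)–(3.23), with data whose entropies converge,
`H(fⁿ(0)) → H(f₀)`. If for every `t > 0`
`∫⁻_{(0,t]×E} e_B(f) ≤ liminf_k ∫⁻_{(0,t]×E} ẽ_{φ(k)}(f^{φ(k)})` (the dissipation of the limit
for the limit kernel `B` against the normalised dissipations (3.24) of the approximations), then
`H(f(t)) + ∫₀ᵗ ∫ D_B(f) dx ds ≤ H(f(0))` for all `t ≥ 0`
(`Literature.Analysis.FluidPDE.HasEntropyInequality`): pass to the limit in (3.7) using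
`H(f(t)) ≤ liminf H(f^{φ(k)}(t))` (`boltzmannEntropy_le_of_frequently_le`), the hypothesis, and
`H(f(0)) = H(f₀)` (`f(0) = f₀` a.e.). [cite: Lions1993Kinetic, Thm III.4 (p. 57) and (E) (p. 54)]
[cite: CIPDiluteGases1994, §5.3 Step 14 (p. 160)] -/
theorem IsDiPernaLionsWeakLimit.hasEntropyInequality_of_dissipation_le_liminf
    {B : E × E → sphere (0 : E) 1 → ℝ} (hB : KineticTheory.IsDiPernaLionsKernel B)
    {f₀ : E → E → ℝ} {fseq : ℕ → ℝ → E → E → ℝ} {φ : ℕ → ℕ} {f : ℝ → E → E → ℝ}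
    (hW : IsDiPernaLionsWeakLimit f₀ fseq φ f)
    {δ : ℕ → ℝ} {Bseq : ℕ → E × E → sphere (0 : E) 1 → ℝ}
    (hdata : IsDiPernaLionsDataApproximation f₀ (fun n => fseq n 0))
    (hsol : ∀ n, IsDiPernaLionsApproximateSolution (δ n) (Bseq n) (fseq n))
    (hbd : UniformDiPernaLionsBounds δ Bseq fseq)
    (hdiss : ∀ t, 0 < t →
      ∫⁻ p in Ioc 0 t ×ˢ univ, eEntropyProduction B (f p.1 p.2)
          ∂((volume : Measure ℝ).prod (volume : Measure E)) ≤
        liminf (fun k => ∫⁻ p in Ioc 0 t ×ˢ univ,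
          eTruncatedEntropyProduction (δ (φ k)) (Bseq (φ k)) (fseq (φ k) p.1 p.2)
            ∂((volume : Measure ℝ).prod (volume : Measure E))) atTop) :
    Literature.Analysis.FluidPDE.HasEntropyInequality B f := by
  intro t ht
  have hH0 : Literature.Analysis.FluidPDE.boltzmannEntropy (f 0) =
      Literature.Analysis.FluidPDE.boltzmannEntropy f₀ := boltzmannEntropy_congr_ae hW.initial_ae
  rcases eq_or_lt_of_le ht with rfl | htpos
  · simp [intervalIntegral.integral_same]
  set D : ℝ≥0∞ := ∫⁻ p in Ioc 0 t ×ˢ univ, eEntropyProduction B (f p.1 p.2)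
    ∂((volume : Measure ℝ).prod (volume : Measure E)) with hD_def
  set Dk : ℕ → ℝ≥0∞ := fun k => ∫⁻ p in Ioc 0 t ×ˢ univ,
    eTruncatedEntropyProduction (δ (φ k)) (Bseq (φ k)) (fseq (φ k) p.1 p.2)
      ∂((volume : Measure ℝ).prod (volume : Measure E)) with hDk_def
  obtain ⟨C, hC⟩ := hbd.dissipation_le
  have hDk_le : ∀ k, Dk k ≤ ENNReal.ofReal C := fun k =>
    (lintegral_mono_set (Set.prod_mono Ioc_subset_Ioi_self Subset.rfl)).trans (hC (φ k))
  have hDk_fin : ∀ k, Dk k ≠ ∞ := fun k => ne_top_of_le_ne_top ENNReal.ofReal_ne_top (hDk_le k)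
  have hDlim : D ≤ liminf Dk atTop := hdiss t htpos
  have hD_le : D ≤ ENNReal.ofReal C :=
    hDlim.trans (liminf_le_of_frequently_le' (Frequently.of_forall hDk_le))
  have hDfin : D ≠ ∞ := ne_top_of_le_ne_top ENNReal.ofReal_ne_top hD_le
  -- the Bochner dissipation of the limit is `D.toReal`
  have hdissB : ∫ s in (0 : ℝ)..t, Literature.Analysis.FluidPDE.totalEntropyProduction B (f s) =
      D.toReal :=
    intervalIntegral_totalEntropyProduction_eq_toReal hB.measurable hB.nonneg hW.measurable
      (fun s hs => hW.nonneg s hs.le) ht hDfin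
  rw [hdissB, hH0]
  refine _root_.le_of_forall_pos_le_add fun ε hε => ?_
  -- (a) the initial entropies converge along the subsequence
  have ha : ∀ᶠ k in atTop, Literature.Analysis.FluidPDE.boltzmannEntropy (fseq (φ k) 0) ≤
      Literature.Analysis.FluidPDE.boltzmannEntropy f₀ + ε / 2 :=
    (hdata.tendsto_boltzmannEntropy.comp hW.strictMono.tendsto_atTop).eventually_le_const
      (by linarith)
  -- (b) the dissipations are eventually almost above `D`
  have hb : ∀ᶠ k in atTop, D.toReal - ε / 2 ≤ (Dk k).toReal := by
    by_cases hD0 : D.toReal - ε / 2 < 0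
    · exact Eventually.of_forall fun k => hD0.le.trans ENNReal.toReal_nonneg
    push Not at hD0
    have h1 : ENNReal.ofReal (D.toReal - ε / 2) < ENNReal.ofReal D.toReal :=
      (ENNReal.ofReal_lt_ofReal_iff (by linarith)).2 (by linarith)
    rw [ENNReal.ofReal_toReal hDfin] at h1
    have hev : ∀ᶠ k in atTop, ENNReal.ofReal (D.toReal - ε / 2) < Dk k :=
      eventually_lt_of_lt_liminf (h1.trans_le hDlim)
    filter_upwards [hev] with k hk
    have := ENNReal.toReal_mono (hDk_fin k) hk.le
    rwa [ENNReal.toReal_ofReal hD0] at this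
  -- (c) the entropy inequality (3.7) along the subsequence
  have hc : ∀ᶠ k in atTop, Literature.Analysis.FluidPDE.boltzmannEntropy (fseq (φ k) t) ≤
      Literature.Analysis.FluidPDE.boltzmannEntropy f₀ + ε - D.toReal := by
    filter_upwards [ha, hb] with k hka hkb
    have := hbd.entropy_le (φ k) t ht
    linarith
  -- (d) lower semicontinuity of the entropy
  have hH := hW.boltzmannEntropy_le_of_frequently_le hsol hbd ht hc.frequently
  linarith

end Assembly

end Literature.MathematicalPhysics.KineticTheory
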